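import Summits.Schanuel.Schanuel.Theorems.ZilberEacRealFibreZeros
import Mathlib.Analysis.SpecialFunctions.Complex.Analytic
import Mathlib.FieldTheory.IsAlgClosed.Basic
import HarnessLib

/-!
# The equimodular class, LVI: exponential points with every large label ON A RAMIFIED CYCLE of
# branches at infinity

HONEST FRAMING.  Cell `pub-schanuel` (Zilber's Exponential-Algebraic Closedness, case ladder;
host summit Schanuel), seat 2, gen 25.  Second brick for the open class "top rows without a simple
nonzero root" (after file LIII, which parametrises the `k`-cycle of branches at infinity through a
`k`-fold top-row root `θ` as `x₀ = s^{-k}`, `y₀ = ψ(s)`, `ψ` analytic at `0`, `ψ(0) = θ`).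
**`exists_ramified_labelled_expPoint`**: for ANY `ψ` analytic at `0` with `ψ(0) = θ = e^τ ≠ 0`, any
`k ≥ 1` and `ε > 0`, every large label `n` carries `s, ζ` with `|ζ| < ε`,
`s^k·(τ + 2πin + ζ) = 1` and `e^{τ + 2πin + ζ} = ψ(s)` — i.e. the exponential curve meets the
parametrised cycle above `z = τ + 2πin + ζ = s^{-k}`.  Proof: with `σ^k = 1/(τ + 2πin)` (small) and
`s = σ·(1 + σ^kζ)^{-1/k}`, the equation is `θe^ζ = ψ(σ(1 + σ^kζ)^{-1/k})`, a small perturbation of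
`θ(e^ζ - 1) = 0`, which has the simple zero `ζ = 0`; zero persistence is proved here in a LOCAL form
(**`exists_zero_near_of_near_param_local`**: continuity on a closed bidisc and holomorphy in the
second variable on a disc suffice), via the tree's minimum-modulus lemma.  What is NOT here: the
witness/phase analysis along the cycle (the phases are polynomials in `(τ + 2πin)^{1/k}` — gen 26).
[folklore]; nothing here is specific to Schanuel's conjecture (neither used nor implied);
Mantova–Masser's question (PLMS 2024 §1 p. 5) and EC(3,2) stay OPEN.
-/

noncomputable section

open Filter Topology Metric Complex

set_option linter.dupNamespace false

namespace Summit.Schanuel.Schanuel.Theorems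

/-! ## Part A. Local zero persistence -/

/-- **Small circles avoiding the zeros (local form)**: if `Φ` is analytic at `x` and not identically
zero near `x`, then around `x` there are arbitrarily small circles on which `|Φ|` has a positive lower
bound. [folklore] -/
theorem exists_sphere_norm_le_local {Φ : ℂ → ℂ} {x : ℂ} (hΦ : AnalyticAt ℂ Φ x)
    (hne : ¬ ∀ᶠ z in 𝓝 x, Φ z = 0) {ε : ℝ} (hε : 0 < ε) :
    ∃ r, 0 < r ∧ r ≤ ε ∧ (∀ z ∈ closedBall x r, ContinuousAt Φ z) ∧
      ∃ m, 0 < m ∧ ∀ z ∈ sphere x r, m ≤ ‖Φ z‖ := by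
  have h1 : ∀ᶠ z in 𝓝[≠] x, Φ z ≠ 0 := hΦ.eventually_eq_zero_or_eventually_ne_zero.resolve_left hne
  obtain ⟨δ, hδ, hδne⟩ : ∃ δ > 0, ∀ z, z ≠ x → dist z x < δ → Φ z ≠ 0 := by
    rw [eventually_nhdsWithin_iff, Metric.eventually_nhds_iff] at h1
    obtain ⟨δ, hδ, h⟩ := h1
    exact ⟨δ, hδ, fun z h0 hz => h hz h0⟩
  obtain ⟨δ', hδ', hcont⟩ : ∃ δ' > 0, ∀ z, dist z x < δ' → ContinuousAt Φ z := by
    obtain ⟨δ', hδ', h⟩ := Metric.eventually_nhds_iff.1 hΦ.eventually_analyticAt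
    exact ⟨δ', hδ', fun z hz => (h hz).continuousAt⟩
  set r := min (min (δ / 2) (δ' / 2)) ε with hr
  have hr0 : 0 < r := lt_min (lt_min (half_pos hδ) (half_pos hδ')) hε
  have hrδ : r < δ := lt_of_le_of_lt ((min_le_left _ _).trans (min_le_left _ _)) (half_lt_self hδ)
  have hrδ' : r < δ' := lt_of_le_of_lt ((min_le_left _ _).trans (min_le_right _ _)) (half_lt_self hδ')
  have hcb : ∀ z ∈ closedBall x r, ContinuousAt Φ z := fun z hz =>
    hcont z (lt_of_le_of_lt (mem_closedBall.1 hz) hrδ')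
  have hcs : ContinuousOn (fun z => ‖Φ z‖) (sphere x r) := fun z hz =>
    (hcb z (sphere_subset_closedBall hz)).norm.continuousWithinAt
  obtain ⟨z₀, hz₀, hmin⟩ := (isCompact_sphere x r).exists_isMinOn
    (NormedSpace.sphere_nonempty.2 hr0.le) hcs
  refine ⟨r, hr0, min_le_right _ _, hcb, ‖Φ z₀‖, ?_, fun z hz => (isMinOn_iff.1 hmin) z hz⟩
  have hz₀r : dist z₀ x = r := mem_sphere.1 hz₀
  refine norm_pos_iff.2 (hδne z₀ ?_ ?_)
  · intro h
    rw [h, dist_self] at hz₀r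
    exact hr0.ne hz₀r
  · rw [hz₀r]; exact hrδ

/-- **Local zero persistence.**  `Φ` continuous on the closed bidisc `closedBall u₀ R × closedBall x₀ R`
and holomorphic in the second variable on `ball x₀ R` for each `u ∈ closedBall u₀ R`; `Φ u₀` has a
zero at `x₀` and is not identically zero near `x₀`.  Then for `u` near `u₀`, `Φ u` has a zero near
`x₀`. [folklore: Hurwitz] -/
theorem exists_zero_near_of_near_param_local {Φ : ℂ → ℂ → ℂ} {u₀ x₀ : ℂ} {R : ℝ} (hR : 0 < R)
    (hcont : ContinuousOn (fun p : ℂ × ℂ => Φ p.1 p.2) (closedBall u₀ R ×ˢ closedBall x₀ R))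
    (hdiff : ∀ u ∈ closedBall u₀ R, DifferentiableOn ℂ (Φ u) (ball x₀ R))
    (hne : ¬ ∀ᶠ z in 𝓝 x₀, Φ u₀ z = 0) (hx₀ : Φ u₀ x₀ = 0) {ε : ℝ} (hε : 0 < ε) :
    ∃ δ > 0, ∀ u, ‖u - u₀‖ < δ → ∃ ζ, ‖ζ - x₀‖ < ε ∧ Φ u ζ = 0 := by
  have han : AnalyticAt ℂ (Φ u₀) x₀ :=
    (hdiff u₀ (mem_closedBall_self hR.le)).analyticAt (ball_mem_nhds x₀ hR)
  obtain ⟨r, hr0, hrε, -, m, hm0, hm⟩ := exists_sphere_norm_le_local han hne (lt_min hε (half_pos hR))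
  have hrε' : r ≤ ε := hrε.trans (min_le_left _ _)
  have hrR : r < R := lt_of_le_of_lt (hrε.trans (min_le_right _ _)) (half_lt_self hR)
  set K : Set (ℂ × ℂ) := closedBall u₀ R ×ˢ sphere x₀ r with hK
  have hKsub : K ⊆ closedBall u₀ R ×ˢ closedBall x₀ R :=
    Set.prod_mono Set.Subset.rfl ((sphere_subset_closedBall).trans (closedBall_subset_closedBall hrR.le))
  have hKc : IsCompact K := (isCompact_closedBall u₀ R).prod (isCompact_sphere x₀ r)
  obtain ⟨δ₁, hδ₁, h₁⟩ := Metric.uniformContinuousOn_iff.1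
    (hKc.uniformContinuousOn_of_continuous (hcont.mono hKsub)) (m / 2) (half_pos hm0)
  have hc2 : ContinuousWithinAt (fun u => Φ u x₀) (closedBall u₀ R) u₀ := by
    have hmap : ContinuousWithinAt (fun u : ℂ => (u, x₀)) (closedBall u₀ R) u₀ :=
      continuousWithinAt_id.prodMk continuousWithinAt_const
    have hmaps : Set.MapsTo (fun u : ℂ => (u, x₀)) (closedBall u₀ R) (closedBall u₀ R ×ˢ closedBall x₀ R) :=
      fun u hu => ⟨hu, mem_closedBall_self hR.le⟩
    have hg : ContinuousWithinAt (fun p : ℂ × ℂ => Φ p.1 p.2) (closedBall u₀ R ×ˢ closedBall x₀ R) (u₀, x₀) :=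
      hcont (u₀, x₀) ⟨mem_closedBall_self hR.le, mem_closedBall_self hR.le⟩
    exact ContinuousWithinAt.comp (f := fun u : ℂ => (u, x₀)) (x := u₀) hg hmap hmaps
  obtain ⟨δ₂, hδ₂, h₂⟩ := Metric.continuousWithinAt_iff.1 hc2 (m / 2) (half_pos hm0)
  refine ⟨min (min δ₁ δ₂) R, by positivity, fun u hu => ?_⟩
  have hu1 : ‖u - u₀‖ < δ₁ := hu.trans_le ((min_le_left _ _).trans (min_le_left _ _))
  have hu2 : ‖u - u₀‖ < δ₂ := hu.trans_le ((min_le_left _ _).trans (min_le_right _ _))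
  have hu3 : ‖u - u₀‖ < R := hu.trans_le (min_le_right _ _)
  have huR : u ∈ closedBall u₀ R := mem_closedBall.2 (by rw [dist_eq_norm]; exact hu3.le)
  have hsphere : ∀ z ∈ sphere x₀ r, m / 2 ≤ ‖Φ u z‖ := by
    intro z hz
    have hzu : (u, z) ∈ K := ⟨huR, hz⟩
    have hzu₀ : (u₀, z) ∈ K := ⟨mem_closedBall_self hR.le, hz⟩
    have hd : dist (u, z) (u₀, z) < δ₁ := by
      rw [Prod.dist_eq, dist_self, dist_eq_norm, max_lt_iff]; exact ⟨hu1, hδ₁⟩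
    have h3 := h₁ (u, z) hzu (u₀, z) hzu₀ hd
    rw [dist_eq_norm] at h3
    have h4 := norm_sub_norm_le (Φ u₀ z) (Φ u z)
    rw [norm_sub_rev] at h4
    linarith [hm z hz]
  have hcentre : ‖Φ u x₀‖ < m / 2 := by
    have h3 := h₂ huR (by rw [dist_eq_norm]; exact hu2)
    rwa [hx₀, dist_zero_right] at h3
  obtain ⟨ζ, hζ, hζ0⟩ := exists_zero_of_norm_lt_of_sphere hr0 hrR (hdiff u huR) hsphere hcentre
  exact ⟨ζ, (by rw [← dist_eq_norm]; exact (mem_ball.1 hζ).trans_le hrε'), hζ0⟩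

/-! ## Part B. Labelled exponential points on a ramified cycle -/

/-- The analytic `k`-th root datum: `g(v) = (1 + v)^{-1/k} = exp(-(1/k) log(1 + v))` for `|v| < 1`
satisfies `g(v)^k (1 + v) = 1`. [folklore] -/
theorem kthRoot_spec {k : ℕ} (hk : 1 ≤ k) {v : ℂ} (hv : ‖v‖ < 1) :
    (Complex.exp (-(1 / (k : ℂ)) * Complex.log (1 + v))) ^ k * (1 + v) = 1 := by
  have h1v : 1 + v ≠ 0 := by
    intro h
    have : ‖v‖ = 1 := by
      have hv' : v = -1 := by linear_combination h
      rw [hv', norm_neg, norm_one]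
    linarith
  rw [← Complex.exp_nat_mul, ← mul_assoc, show ((k : ℂ)) * -(1 / (k : ℂ)) = -1 by
    field_simp [show (k : ℂ) ≠ 0 from Nat.cast_ne_zero.2 (by omega)], neg_one_mul, Complex.exp_neg,
    Complex.exp_log h1v, inv_mul_cancel₀ h1v]

/-- **Exponential points with every large label on a ramified cycle at infinity.**  See the module
docstring. [folklore] (new in this form) -/
theorem exists_ramified_labelled_expPoint {ψ : ℂ → ℂ} (hψ : AnalyticAt ℂ ψ 0) {θ : ℂ} (hθ0 : θ ≠ 0)
    (hψ0 : ψ 0 = θ) (τ : ℂ) (hτ : Complex.exp τ = θ) {k : ℕ} (hk : 1 ≤ k) {ε : ℝ} (hε : 0 < ε) :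
    ∃ K : ℕ, ∀ n : ℕ, K ≤ n → ∃ s ζ : ℂ, ‖ζ‖ < ε ∧
      s ^ k * (τ + (n : ℂ) * (2 * Real.pi * I) + ζ) = 1 ∧
      Complex.exp (τ + (n : ℂ) * (2 * Real.pi * I) + ζ) = ψ s := by
  classical
  -- the maps
  set g : ℂ → ℂ := fun v => Complex.exp (-(1 / (k : ℂ)) * Complex.log (1 + v)) with hg
  set S : ℂ → ℂ → ℂ := fun σ ζ => σ * g (σ ^ k * ζ) with hS
  set Φ : ℂ → ℂ → ℂ := fun σ ζ => θ * Complex.exp ζ - ψ (S σ ζ) with hΦ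
  -- analyticity of `g` on `|v| < 1`
  have hgan : ∀ v : ℂ, ‖v‖ < 1 → AnalyticAt ℂ g v := by
    intro v hv
    exact (analyticAt_const.mul ((analyticAt_const.add analyticAt_id).clog (mem_slitPlane_of_norm_lt_one hv))).cexp
  have hg0 : g 0 = 1 := by simp [hg]
  -- a radius for `ψ`
  obtain ⟨ρ, hρ, hψan⟩ : ∃ ρ > 0, ∀ z : ℂ, ‖z‖ < ρ → AnalyticAt ℂ ψ z := by
    obtain ⟨ρ, hρ, h⟩ := Metric.eventually_nhds_iff.1 hψ.eventually_analyticAt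
    exact ⟨ρ, hρ, fun z hz => h (by rwa [dist_zero_right])⟩
  -- `S` is continuous at `(0, 0)` with value `0`: a radius `R₁` with `|S| < ρ`
  have hSval : ∀ σ ζ : ℂ, ‖σ‖ ≤ 1 / 2 → ‖ζ‖ ≤ 1 / 2 → ‖σ ^ k * ζ‖ < 1 := by
    intro σ ζ hσ hζ
    rw [norm_mul, norm_pow]
    have h1 : ‖σ‖ ^ k ≤ 1 / 2 := by
      calc ‖σ‖ ^ k ≤ ‖σ‖ ^ 1 := pow_le_pow_of_le_one (norm_nonneg _) (by linarith) hk
        _ ≤ 1 / 2 := by rw [pow_one]; exact hσ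
    nlinarith [norm_nonneg ζ, pow_nonneg (norm_nonneg σ) k]
  have hScont : ∀ σ ζ : ℂ, ‖σ‖ ≤ 1 / 2 → ‖ζ‖ ≤ 1 / 2 →
      ContinuousAt (fun p : ℂ × ℂ => S p.1 p.2) (σ, ζ) := by
    intro σ ζ hσ hζ
    simp only [hS]
    have h1 : ContinuousAt (fun p : ℂ × ℂ => p.1 ^ k * p.2) (σ, ζ) :=
      ((continuous_fst.pow k).mul continuous_snd).continuousAt
    exact continuousAt_fst.mul ((hgan _ (hSval σ ζ hσ hζ)).continuousAt.comp_of_eq h1 rfl)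
  obtain ⟨R₁, hR₁, hR₁S⟩ : ∃ R₁ > 0, ∀ σ ζ : ℂ, ‖σ‖ < R₁ → ‖ζ‖ < R₁ → ‖S σ ζ‖ < ρ := by
    have hc := hScont 0 0 (by norm_num) (by norm_num)
    have h0 : S 0 0 = 0 := by simp [hS]
    obtain ⟨R₁, hR₁, h⟩ := Metric.continuousAt_iff.1 hc ρ hρ
    refine ⟨R₁, hR₁, fun σ ζ hσ hζ => ?_⟩
    have := h (x := (σ, ζ)) (by rw [Prod.dist_eq, dist_zero_right, dist_zero_right, max_lt_iff]; exact ⟨hσ, hζ⟩)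
    rwa [h0, dist_zero_right] at this
  set R : ℝ := min (1 / 2) (R₁ / 2) with hRdef
  have hR : 0 < R := by positivity
  have hR2 : R ≤ 1 / 2 := min_le_left _ _
  have hRR₁ : R < R₁ := lt_of_le_of_lt (min_le_right _ _) (half_lt_self hR₁)
  -- hypotheses of the persistence lemma
  have hcontK : ContinuousOn (fun p : ℂ × ℂ => Φ p.1 p.2) (closedBall 0 R ×ˢ closedBall 0 R) := by
    rintro ⟨σ, ζ⟩ ⟨hσ, hζ⟩
    rw [mem_closedBall, dist_zero_right] at hσ hζ
    refine ContinuousAt.continuousWithinAt ?_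
    simp only [hΦ]
    refine (continuousAt_const.mul (Complex.continuous_exp.continuousAt.comp continuousAt_snd)).sub ?_
    have hS' := hScont σ ζ (hσ.trans hR2) (hζ.trans hR2)
    exact (hψan _ (hR₁S σ ζ (lt_of_le_of_lt hσ hRR₁) (lt_of_le_of_lt hζ hRR₁))).continuousAt.comp_of_eq
      hS' rfl
  have hdiffK : ∀ σ ∈ closedBall (0 : ℂ) R, DifferentiableOn ℂ (Φ σ) (ball 0 R) := by
    intro σ hσ ζ hζ
    rw [mem_closedBall, dist_zero_right] at hσ
    rw [mem_ball, dist_zero_right] at hζ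
    refine DifferentiableAt.differentiableWithinAt ?_
    simp only [hΦ, hS]
    refine (Complex.differentiable_exp.differentiableAt.const_mul _).sub ?_
    have h1 : DifferentiableAt ℂ (fun ζ : ℂ => σ ^ k * ζ) ζ := (differentiableAt_id.const_mul _)
    have h2 : DifferentiableAt ℂ (fun ζ : ℂ => σ * g (σ ^ k * ζ)) ζ :=
      ((hgan _ (hSval σ ζ (hσ.trans hR2) (hζ.le.trans hR2))).differentiableAt.comp ζ h1).const_mul _
    exact (hψan _ (hR₁S σ ζ (lt_of_le_of_lt hσ hRR₁) (hζ.trans hRR₁))).differentiableAt.comp ζ h2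
  have hΦ0 : ∀ ζ, Φ 0 ζ = θ * (Complex.exp ζ - 1) := by
    intro ζ
    simp only [hΦ, hS, zero_pow (by omega : k ≠ 0), zero_mul, hψ0]
    ring
  have hx₀ : Φ 0 0 = 0 := by rw [hΦ0]; simp
  have hne : ¬ ∀ᶠ ζ in 𝓝 (0 : ℂ), Φ 0 ζ = 0 := by
    intro h
    have hd : HasDerivAt (fun ζ => θ * (Complex.exp ζ - 1)) θ 0 := by
      simpa using ((Complex.hasDerivAt_exp 0).sub_const 1).const_mul θ
    have h0 : HasDerivAt (fun ζ => θ * (Complex.exp ζ - 1)) 0 0 := by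
      refine (hasDerivAt_const (0 : ℂ) (0 : ℂ)).congr_of_eventuallyEq ?_
      filter_upwards [h] with ζ hζ
      rw [← hΦ0]; exact hζ
    exact hθ0 (hd.unique h0)
  obtain ⟨δ, hδ, hpers⟩ := exists_zero_near_of_near_param_local hR hcontK hdiffK hne hx₀ (lt_min hε hR)
  -- large labels give small `σ`
  set δ' : ℝ := min δ R with hδ'
  have hδ'0 : 0 < δ' := lt_min hδ hR
  obtain ⟨K, hK⟩ : ∃ K : ℕ, ∀ n : ℕ, K ≤ n → (δ' ^ k)⁻¹ + ‖τ‖ < 2 * Real.pi * n := by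
    obtain ⟨K, hK⟩ := exists_nat_gt (((δ' ^ k)⁻¹ + ‖τ‖) / (2 * Real.pi))
    refine ⟨K, fun n hn => ?_⟩
    rw [div_lt_iff₀ Real.two_pi_pos] at hK
    have : (K : ℝ) ≤ n := by exact_mod_cast hn
    nlinarith [Real.pi_pos]
  refine ⟨K, fun n hn => ?_⟩
  set τn : ℂ := τ + (n : ℂ) * (2 * Real.pi * I) with hτn
  have hτnorm : (δ' ^ k)⁻¹ < ‖τn‖ := by
    have h1 : ‖(n : ℂ) * (2 * Real.pi * I)‖ = 2 * Real.pi * n := by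
      rw [norm_mul, Complex.norm_natCast]
      simp [abs_of_pos Real.pi_pos]
      ring
    have h2 : ‖(n : ℂ) * (2 * Real.pi * I)‖ - ‖τ‖ ≤ ‖τn‖ := by
      rw [hτn]
      have := norm_sub_norm_le ((n : ℂ) * (2 * Real.pi * I)) (-τ)
      rw [norm_neg, sub_neg_eq_add, add_comm] at this
      linarith
    linarith [hK n hn]
  have hτn0 : τn ≠ 0 := by
    intro h; rw [h, norm_zero] at hτnorm; exact absurd hτnorm (not_lt.2 (by positivity))
  -- a `k`-th root of `1/τn`
  obtain ⟨σ, hσk⟩ := IsAlgClosed.exists_pow_nat_eq τn⁻¹ (by omega : 0 < k)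
  have hσnorm : ‖σ‖ < δ' := by
    have h1 : ‖σ‖ ^ k = ‖τn‖⁻¹ := by rw [← norm_pow, hσk, norm_inv]
    have h2 : ‖τn‖⁻¹ < δ' ^ k := by
      rw [inv_lt_comm₀ (norm_pos_iff.2 hτn0) (by positivity)]
      exact hτnorm
    by_contra hle
    push Not at hle
    have : δ' ^ k ≤ ‖σ‖ ^ k := pow_le_pow_left₀ hδ'0.le hle k
    linarith
  obtain ⟨ζ, hζ, hΦζ⟩ := hpers σ (by rw [sub_zero]; exact hσnorm.trans_le (min_le_left _ _))
  rw [sub_zero] at hζ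
  have hζε : ‖ζ‖ < ε := hζ.trans_le (min_le_left _ _)
  have hζR : ‖ζ‖ < R := hζ.trans_le (min_le_right _ _)
  have hσR : ‖σ‖ ≤ 1 / 2 := (hσnorm.le.trans (min_le_right _ _)).trans hR2
  refine ⟨S σ ζ, ζ, hζε, ?_, ?_⟩
  · -- `s^k (τn + ζ) = 1`
    have hv : ‖σ ^ k * ζ‖ < 1 := hSval σ ζ hσR (hζR.le.trans hR2)
    have hroot : g (σ ^ k * ζ) ^ k * (1 + σ ^ k * ζ) = 1 := kthRoot_spec hk hv
    have e1 : τn + ζ = τn * (1 + σ ^ k * ζ) := by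
      rw [hσk]; field_simp
    simp only [hS]
    rw [mul_pow, e1, show σ ^ k * g (σ ^ k * ζ) ^ k * (τn * (1 + σ ^ k * ζ)) =
      (σ ^ k * τn) * (g (σ ^ k * ζ) ^ k * (1 + σ ^ k * ζ)) by ring, hroot, mul_one, hσk,
      inv_mul_cancel₀ hτn0]
  · -- `e^{τn + ζ} = ψ s`
    have hper : Complex.exp ((n : ℂ) * (2 * Real.pi * I)) = 1 := by
      have := Complex.exp_int_mul_two_pi_mul_I (n : ℤ)
      exact_mod_cast this
    have hexp : Complex.exp (τ + (n : ℂ) * (2 * Real.pi * I) + ζ) = θ * Complex.exp ζ := by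
      rw [Complex.exp_add, Complex.exp_add, hτ, hper, mul_one]
    have h0 : θ * Complex.exp ζ - ψ (S σ ζ) = 0 := hΦζ
    rw [hexp]
    linear_combination h0

end Summit.Schanuel.Schanuel.Theorems
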